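import Mathlib
import HarnessLib
import HarnessLib.Audit
import Summits.PneNP.Statement
import Literature.Algebra.EuclideanLattices.DualLattice
import Literature.Algebra.EuclideanLattices.Encoding
import Literature.Computability.Complexity.Promise
import Literature.Computability.Complexity.Classes
import Literature.Computability.Complexity.NondeterministicProofs
import Literature.Computability.MetaComplexity.SumOfSquares
import Summits.PneNP.PneNP.Theorems.SzkEntropyCookModelBridge
import Literature.Computability.MetaComplexity.ProofSystems
import Summits.PneNP.PneNP.Theorems.LatticeMagicTargetDefs
import HarnessLib.Audit.Status.Attr

/-!
Route: LatticeMagic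

DORMANT since 2026-08-25T02:50:40Z (reconciler: no traction for 7.3 d (last activity item-evidence-added at 2026-08-17T18:56:50Z); parked, not closed — `ledger route dormant route-PneNP-LatticeMagic --off` to reactivate) — unstaffed, not closed; items shared with open routes are served there. `ledger route dormant <id> --off` reactivates.

Route PneNP/LatticeMagic — "NO(GapCVP_c) has no polynomially bounded certificate system, for some
constant c" (card PneNP/PneNP/lattice-magic-function-certificate-ladder).

X in words: there is a constant factor c ≥ 1 such that the promise problem GapCVP_c is not in
promise-coNP, i.e. "t is farther than c·d from the lattice L(B)" admits no sound, complete,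
polynomially bounded, polynomial-time verifiable certificate system (Q ∈ PromiseCoNP = promiseLift
coNP is literally the existence of such a system: an NP language containing every NO-instance code
and no YES-instance code). By Aharonov–Regev the same statement at factor C√n is FALSE (GapCVP_{C√n}
∈ PromiseCoNP; tree: Literature.Algebra.EuclideanLattices.gapCVP_sqrt_mem_promiseCoNP_holds); by
ABSS97 GapCVP_c is NP-hard for every constant c, so X ⟺ NP ≠ coNP (SanityFromNPHardness records the
easy direction). The route reads the interval γ ∈ [O(1), √n) as a PROOF-COMPLEXITY ladder of
certificate classes for "far from the lattice" and asks, class by class, at which factor γ each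
class goes blind. Honest shape (both route reviews): the rungs MagicFunctionsPersist /
TaylorMinorantsBuySqrtK / BooleanSosBlindAtConstantFactor bound specific certificate classes and do
NOT imply X; X is the item Target (top rung) and the deciding theorem goes through Target alone.

Lean: ∃ c : ℝ, 1 ≤ c ∧ Literature.Computability.Complexity.PromiseProblem.ofEncoding
Literature.Algebra.EuclideanLattices.gapCVPInstanceEncoding
(Literature.Algebra.EuclideanLattices.GapCVP.yes (fun _ => c))
(Literature.Algebra.EuclideanLattices.GapCVP.no (fun _ => c)) ∉
Literature.Computability.Complexity.PromiseCoNP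
(rev 2, cone repair: this term is the definiens of
`Literature.Algebra.EuclideanLattices.gapCVPPromise (fun _ => c)` written out — `Iff.rfl` with the
rev-1 text, checked in the planner's Sketch2.lean — so that the route file no longer imports
LatticeComplexity.lean, whose unproved XL facts GapSVPQuantumHardness /
gapSVP_const_isNPHardRandomized / usvp_of_dihedralCoset sat in the route's import cone through
GapCVPCoNPWitness/LatticeGapCVPNPcoNP → LatticeGapNPcoNPLemmaA1 → LatticeGapNPcoNP.)

Deciding theorem (D-0027 §2.1; glue.lean, sorry-free, axioms propext / Classical.choice /
Quot.sound): closes : Target → MagicFunctionsPersist → BooleanSosBlindAtConstantFactor →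
TaylorMinorantsBuySqrtK → SanityFromNPHardness → GapCVPInPromiseNP → ModelBridge → PneNP. It USES
only Target, GapCVPInPromiseNP (GapCVP_γ ∈ PromiseNP for γ ≥ 1 — verbatim the definiens of the
PROVED tree fact gapCVP_mem_promiseNP, AharonovRegev2005 p.2 "containment in NP is trivial"),
ModelBridge (PNPWave0.P Bool = Classes.P ∧ PNPWave0.NP Bool = Nondeterministic.NP — verbatim the
PROVED bridges P_bool_eq ∧ NP_bool_eq) and the in-cone theorems co_P_holds, P_subset_NP_holds: if
¬PneNP, the NP separator L of GapCVP_c lies in PNPWave0.P Bool = Classes.P = co P, so Lᶜ ∈ P ⊆ NP,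
i.e. L ∈ coNP separates GapCVP_c, contradicting Target. The Assembly item is restated to the same
honest form GapCVPInPromiseNP → ModelBridge → Target → PneNP (provable now; proof attached as
evidence). The two support items exist only because the files proving their `_holds` theorems
(GapCVPVerifier.lean; ClayProblem.lean / ClayProblemProofs.lean, which also declare the open
conjecture NPNotSubsetPPoly) would put unproved named facts back into the import cone; each closes
by a single `exact` in a Theorems file (terms recorded on the items).

Rationale: WHY THIS LINE. (Geometry of numbers + harmonic analysis + SOS proof complexity → NP ≠ coNP). AR05's
coNP witness for GapCVP_{C√n} is a positive-type dual cosine sum f_W(x) = N⁻¹Σcos 2π⟨w_j,x⟩ whose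
soundness proof is the order-1 Taylor minorant cos y ≥ 1 − y²/2 plus the PSD test ‖WWᵀ/N‖ ≤ κ
(AharonovRegev2005 §6; in tree as FarCert/Accepts, GapCVPCoNPWitness.lean — no longer imported by
the route file, see RANKED CRUXES). ABB+23 (arXiv:2211.11693, Thm 1.2 and pp.9–10) push order-k
Taylor + moment tests to factor ≈ √(n/k) in time n^{O(k)} (for SVP) and write that certifying the
order-k minorant on a ball is "entirely unclear" in general (it is a 2→2k-norm problem, BBHKSZ12).
The route turns this into statements: (i) a LIMIT theorem for every Taylor-minorant certificate of
order K — such certificates are blind whenever L* has no vector shorter than 2√(Kn)/r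
(sphere-average of the minorant; TaylorMinorantsBuySqrtK), which with transference tightness
λ₁(L*)·dist(t,L) = Ω(n) (random q-ary lattices; Banaszczyk1993 for the matching upper bound)
explains AR's √n and ABB+'s √(n/k) as ORDER thresholds and says constant γ needs order Ω(n/γ²); (ii)
the claim that √n is a CERTIFICATION threshold and not a positivity threshold: on the very instances
where all low-order certificates are blind, t-ADAPTED dual cosine sums with poly(n) terms still
separate t from the d-tube around L at CONSTANT factor (MagicFunctionsPersist; heuristic: phases of
long dual vectors selected by their phase at t are pseudo-random on the tube, margin 1 − O(√(n log
n/N)); AR05 p.4 Remark only rules this out for the Gaussian f); (iii) the first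
standard-proof-system rung: degree-n^δ Boolean SOS (tree's IsPseudoexpectation/SatisfiesIdentity)
cannot refute the bit-encoded closeness system of some poly-size NO-instances of GapCVP_{γ₀}
(BooleanSosBlindAtConstantFactor; cf. KMOW arXiv:1701.04521, Grigoriev's knapsack, GJJPR20
arXiv:2009.01874 for the nearest 'far from a structured set' SOS bound, Tulsiani 2009 for gadget
transfer through AroraEtAl1997). IMPORTED FROM: geometry of numbers (transference, discrete
Gaussian/smoothing — tree), harmonic analysis (positive-type functions, Taylor minorants of cos),
SOS proof complexity (pseudoexpectations — tree), probabilistic method (chaining over the tube) for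
#2.
RANKED CRUXES. #2 MagicFunctionsPersist (most informative: decides whether the obstruction below √n
is Fourier positivity or certification; refutation re-instates the card's original 'magic functions
run out' story). CAVEAT recorded by the gen-1 route review (refuter 4766edce, Persist.lean on
stmt-PneNP-2328): AS TYPED the persistence clause is witnessed at the half-lattice point t = ½Σbᵢ by
the n-term dual-basis cosine sum as soon as λ₁·λ₁* > 4√n (Conway–Thompson-type lattices), so a proof
of the typed form would NOT decide positivity-vs-certification; tenure should restate it with ∀ t
over the distance window and a normalised margin (new decl, the typed one kept) — not done in this
cone/glue repair. #4 BooleanSosBlindAtConstantFactor (first lattice proof-complexity theorem in a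
standard system; degree vs bit-size; parity-far 2ℤⁿ instances are refuted in degree 6, so instance
choice is the content). Support: TaylorMinorantsBuySqrtK (rank 3 kept for ordering; calibration of
the whole AR/ABB+ family, re-derived and judged TRUE by both reviews — sphere/Gaussian average of
the minorant), SanityFromNPHardness (X is no stronger than NP ≠ coNP given ABSS97 NP-hardness, which
enters as a hypothesis), and the two provable-now bookkeeping items of the deciding theorem,
GapCVPInPromiseNP (= gapCVP_mem_promiseNP verbatim; closes by `exact
Literature.Algebra.EuclideanLattices.gapCVP_mem_promiseNP_holds`) and ModelBridge (= P_bool_eq ∧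
NP_bool_eq verbatim; closes by `⟨P_bool_eq_holds, NP_bool_eq_holds⟩`). Target rank 0. Rev 2
(cone/glue repair) DROPPED: FarCertBlindBelowSqrtN (the K = 1 corollary of TaylorMinorantsBuySqrtK
for the tree's Aharonov–Regev verifier: its statement needs FarCert from GapCVPCoNPWitness.lean,
whose import cone carries LatticeComplexity.lean's unproved XL facts; it comes back as a
Theorems-side lemma filed with `--supports TaylorMinorantsBuySqrtK`, where imports are free) ;
RESTATED: the Assembly item, to GapCVPInPromiseNP → ModelBridge → Target → PneNP (rank 1, provable
now — it is the body of `closes`; rev 1 named the facts gapCVP_mem_promiseNP, P_bool_eq, NP_bool_eq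
— now the two support items — and co_P, P_subset_NP — proved in the cone and used as theorems).
KILL CRITERIA. GapCVP_c ∈ PromiseCoNP for every constant c (¬X) kills the route with NP = coNP.
GapCVP_{n^{1/2−δ}} ∈ PromiseCoNP (AR not optimal; Bennett's SIGACT open problems; AR05 Speculation
1.5 at √(n/log n)) does NOT kill it but re-calibrates every rung. Refutation of #2 (separators
provably run out on some lattice family) flips the mechanism back to LP-bound limitations
(Cohn–Elkies side) — the route survives with #3/#4. Refutation of #4 by an actual low-degree SOS
refutation of random q-ary instances would be an algorithmic surprise (record, pivot to worst-case
gadget instances). Neither GapCVPInPromiseNP nor ModelBridge can fail (proved tree facts restated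
verbatim); a bounce there means a renamed constant, not mathematics.
NOT DECOMPOSED YET. The next rung (Taylor atoms + integer case-splits on dual functionals ⟨a_j,z⟩ =
branch-and-bound/stabbing-planes flavour; definition requested as DualPhaseBranchingRefutation),
cutting planes on the IP encoding, Frege; the SVP variants (GMSS/Lemma A.1 transfers are in tree);
any claim that the rungs are linearly ordered (the auditor's flag: they need not be — #3 vs #4
incomparability is itself a question for tenure).
CHEAPEST FALSIFIER. (i) #2: exhibit a trivial persistence witness — DONE by the gen-1 review
(half-lattice point + dual basis, Persist.lean): the typed statement is true for a transference
reason, hence the restate request above; (ii) #4: run degree-4/6 Boolean SOS (kit; n ≤ 12, m ≤ 6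
coefficient bits) on the bit-encoded closeness system of random q-ary NO-instances with a planted
far target — a constant-degree refutation on random instances forces the pivot to worst-case ABSS
gadget instances (degree-6 already kills parity-far 2ℤⁿ instances, refuter note on stmt-PneNP-2330);
(iii) the line: nothing cheap kills X itself (X ⟺ NP ≠ coNP); GapCVP_{n^{1/2−δ}} ∈ PromiseCoNP would
re-calibrate the rungs, not kill them.

Novelty: Searched 2026-08-15 (this session: lit read arXiv:2211.11693 pp.5–10 and
paper:doi-10-1109-focs-2004-35 pp.4–5; lit search --hybrid ×2 (local; remote cascade rc 75); lit
galaxy search --star all ×3; plus the card's two novelty audits). Nearest prior art: (1)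
AharonovRegev2005 §6 + p.4 Remark — the order-1 certificate and the √n limit OF THE GAUSSIAN f via
Banaszczyk1993; (2)
Aggarwal–Bennett–Brakerski–Golovnev–Kumar–Li–Peters–Stephens-Davidowitz–Vaikuntanathan
arXiv:2211.11693 Thm 1.2, pp.9–10 — order-k Taylor/moment certificates reach √(n/k) in time n^{O(k)}
for SVP; they state the certification of the order-k minorant is 'entirely unclear' (2→4 norms,
BBHKSZ12 arXiv:1205.4484) and pose no lower bound; (3) GoldreichGoldwasser2000, Bennett ECCC
TR22-170 (certificate UPPER bounds below √n posed as open), Bogdanov–Rosen ICALP 2023 / GJJPR20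
arXiv:2009.01874 (smoothing certificates vs SOS for Nearest Boolean Vector — the order of strength
there is the reverse of a linear ladder). DELTA: (a) a limitation theorem for ALL order-K
Taylor-minorant certificates (any weights, any number of dual vectors, any SOS degree) — blind
unless L* has a vector shorter than 2√(Kn)/r — making AR's √n and ABB+'s √(n/k) thresholds of Taylor
ORDER (not found stated anywhere); (b) the function-level claim that t-adapted poly-size dual cosine
sums separate at CONSTANT factor on transference-tight lattices, so √n is a certification threshold,
contradicting the natural reading of AR05's p.4 Remark (new, u  [refs: 2211.11693, 1205.4484, 2009.01874, paper:doi-10-1109-focs-2004-35, AharonovRegev2005, Banaszczyk1993, GoldreichGoldwasser2000, AroraEtAl1997, CookReckhow1979]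

Barriers (technique_class: proof-complexity, dual-certificates, sos-lower-bounds): technique_class: proof-complexity, dual-certificates, sos-lower-bounds
- Literature.Barriers.PneNP.LatticeGapCoNP : the premise, not an obstacle — it caps NP-HARDNESS at γ
< c√n (np_subset_coNP_of_isNPHard_gapCVP, proved) while the route bounds CERTIFICATE CLASSES from
below at constant γ, where GapCVP is NP-hard (AroraEtAl1997); the two together locate the proof
complexity of 'far from the lattice' in γ ∈ [O(1), √n). Nothing in the route reduces an NP-hard
problem to GapCVP_{≥√n}.
- Literature.Barriers.PneNP.FeasibleInterpolationEF : bites only at Frege/EF-strength rungs, which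
the route does not claim; Taylor-minorant certificates and Boolean SOS are systems where lower
bounds are provable outright (TaylorMinorantsBuySqrtK is unconditional; SOS degree bounds à la
Grigoriev/KMOW need no interpolation). The top X inherits the EF frontier like every NP ≠ coNP
thesis — conceded.
- Literature.Barriers.PneNP.LowDegreeCounterexamples : relevant to BooleanSosBlindAtConstantFactor
and to any pseudo-calibration on random q-ary lattices — lattices carry exact arithmetic structure
(LLL/Gaussian elimination are 'beyond low degree'); recorded as a design constraint: an SOS degree
bound here is a statement about one proof system, never read as algorithmic hardness, and instances
are existentially chosen (worst-case gadget instances remain available if random ones leak).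
- Literature.Barriers.PneNP.Relativization / .Algebrization / .NaturalProofs : not engaged by the
rungs (explicit proof

History (route lifecycle, newest last):
- 2026-08-15T16:21:35Z · rev 2: restated Target (stmt-PneNP-2326), SanityFromNPHardness (stmt-PneNP-2332), Assembly (stmt-PneNP-2327) — route-repair (cone + glue, rev 2): imports GapCVPCoNPWitness, LatticeGapCVPNPcoNP, ClayProblem dropped (+NondeterministicProofs added) — they carried 4 of the 5 (planner-rbadge-PneNP-LatticeMagic-22161f16-g2-0)
- 2026-08-15T16:21:35Z · rev 2: dropped FarCertBlindBelowSqrtN — route-repair (cone + glue, rev 2): imports GapCVPCoNPWitness, LatticeGapCVPNPcoNP, ClayProblem dropped (+NondeterministicProofs added) — they carried 4 of the 5 (planner-rbadge-PneNP-LatticeMagic-22161f16-g2-0)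
- 2026-08-16T04:14:11Z · AUTO-CRUX (backfill): Target — hypotheses of the deciding theorem that nothing in the route derives are cruxes (operator:999:1085951)
- 2026-08-25T02:50:40Z · DORMANT — reconciler: no traction for 7.3 d (last activity item-evidence-added at 2026-08-17T18:56:50Z); parked, not closed — `ledger route dormant route-PneNP-LatticeMag (operator:999:126691)

sub-problem: PneNP · status: dormant · opened planner-plancard-PneNP-PneNP-lattice-magic-fu-6154e8bb-0 2026-08-15T11:03:05Z · rev 3 · ledger route-PneNP-LatticeMagic
GENERATED by the gate from the ledger (D-0016/17). Provers cite these decls: `theorem foo : Summit.PneNP.PneNP.Theses.LatticeMagic.<Decl> := …` in Summits/PneNP/PneNP/Theorems/<Name>.lean.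
-/

namespace Summit.PneNP.PneNP.Theses.LatticeMagic

open scoped BigOperators Topology Manifold Classical MeasureTheory ProbabilityTheory Matrix InnerProductSpace ComplexConjugate ContinuousMap
open Filter Set Function TopologicalSpace MeasureTheory

attribute [summit_statement] _root_.PneNP

open Literature.PNP

-- earlier Target (stmt-PneNP-2326, replaced 2026-08-15T16:21:35Z -> stmt-PneNP-10709): retired by None — ∃ c : ℝ, 1 ≤ c ∧ Literature.Algebra.EuclideanLattices.gapCVPPromise (fun _ => c) ∉ Literature.Computability.Complexity.PromiseCoNP
/-- item stmt-PneNP-10709 · crux (kind.auto-crux: conjecture-grade) · rank 0 · open · by planner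
why it might fail: NP ≠ coNP read on CVP: false iff SOME certificate system, however unnatural, is p-bounded for 'far from the lattice' at every constant factor; FALSE at factor C√n (AR05; tree gapCVP_sqrt_mem_promiseCoNP_holds) and 2^{εn}-size coMA certificates exist at constant γ (ABB+23 Thm 1.3).
sources: AharonovRegev2005, AroraEtAl1997, CookReckhow1979, arXiv:2211.11693
[target] For some constant c ≥ 1, GapCVP_c ∉ PromiseCoNP: no NP language contains the codes of all
NO-instances ((B,t),d) (dist(t,L(B)) > c·d) and of no YES-instance (dist ≤ d) — 'far from the
lattice' has no polynomially bounded certificate system at constant factor (promiseLift coNP IS that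
statement). Equivalent to NP ≠ coNP given deterministic NP-hardness of GapCVP_c (AroraEtAl1997;
SanityFromNPHardness); FALSE at factor C√n (AharonovRegev2005 Thm 1.1; tree:
gapCVP_sqrt_mem_promiseCoNP_holds); 2^{εn}-size coMA certificates exist at constant factor
(arXiv:2211.11693 Thm 1.3). Top of the certificate ladder; the rungs below are blindness theorems
for certificate CLASSES and do not imply it. REV 2 (cone repair): `PromiseProblem.ofEncoding
gapCVPInstanceEncoding (GapCVP.yes _) (GapCVP.no _)` is the definiens of
`Literature.Algebra.EuclideanLattices.gapCVPPromise` written out (Iff.rfl with the rev-1 text,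
planner Sketch2.lean) so that the route file does not import LatticeComplexity.lean (unproved XL
facts GapSVPQuantumHardness, gapSVP_const_isNPHardRandomized, usvp_of_dihedralCoset). -/
@[route_item "route-PneNP-LatticeMagic", crux]
def Target : Prop :=
  ∃ c : ℝ, 1 ≤ c ∧ Literature.Computability.Complexity.PromiseProblem.ofEncoding Literature.Algebra.EuclideanLattices.gapCVPInstanceEncoding (Literature.Algebra.EuclideanLattices.GapCVP.yes (fun _ => c)) (Literature.Algebra.EuclideanLattices.GapCVP.no (fun _ => c)) ∉ Literature.Computability.Complexity.PromiseCoNP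

/-- item stmt-PneNP-2328 · crux · rank 2 · closed · proved by Summit.PneNP.PneNP.Theorems.LatticeMagicMagicFunctionsPersist.MagicFunctionsPersist_of @ e8268ff45bb1 (prover) · by planner
why it might fail: Heuristic only: phases of the N ≤ n^C phase-selected dual vectors are modelled as independent on the d-ball; additive relations among the selected w_j or rational lines through t may correlate them and force N superpolynomial — or separators truly run out below √n (AR05 p.4 Remark, Gaussian f).
sources: AharonovRegev2005, arXiv221111693, Banaszczyk1993, MicciancioRegev2007
[crux] '√n is a CERTIFICATION threshold, not a positivity threshold.' For some constant γ₀ and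
exponent C, in infinitely many dimensions n there are a full-rank lattice L ⊆ ℝⁿ, a point t and a
radius d with γ₀·d < dist(t,L) ≤ 2γ₀·d such that (BLINDNESS) every nonzero dual vector has norm ≥
2√n/d — so by TaylorMinorantsBuySqrtK at K = 1 every Aharonov–Regev-type certificate at radius d is
blind (cf. FarCertBlindBelowSqrtN) — and yet (PERSISTENCE) some N ≤ n^C dual vectors w_j and a
threshold θ give Σ_j cos 2π⟨w_j,t⟩ < Nθ ≤ Σ_j cos 2π⟨w_j,x⟩ for every x within d of L: a
uniform-weight dual cosine sum of polynomial size still separates t from the d-tube at CONSTANT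
factor, at the level of functions. Intended witnesses: random q-ary lattices Λ_q(G), k = n/2, q ≈ n
(λ₁(L*)·μ(L) ≈ n/(2πe): transference-tight; Banaszczyk1993 gives ≤ n/2 always), t generic at
distance ≈ μ, w_j = dual vectors of norm ≈ R SELECTED BY THEIR PHASE AT t (⟨w_j,t⟩ ≈ 1/2 mod 1):
then the sum at t is ≈ −0.8N while on the tube the phases spread — chaining over an (R·d)-net of the
ball gives min ≥ −C√(n log n/N)·N, and the conditioned mean Σ_m a_m φ(mt ± e) is ≥ −tiny by
smoothing-type tail bounds (φ = Fourier transf -/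
@[route_item "route-PneNP-LatticeMagic", crux]
def MagicFunctionsPersist : Prop :=
  ∃ γ₀ : ℝ, 1 ≤ γ₀ ∧ ∃ C : ℕ, ∀ n₀ : ℕ, ∃ (n : ℕ) (L : Submodule ℤ (EuclideanSpace ℝ (Fin n))) (_ : DiscreteTopology L) (_ : IsZLattice ℝ L) (t : EuclideanSpace ℝ (Fin n)) (d : ℝ), n₀ ≤ n ∧ 0 < d ∧ γ₀ * d < Metric.infDist t (L : Set (EuclideanSpace ℝ (Fin n))) ∧ Metric.infDist t (L : Set (EuclideanSpace ℝ (Fin n))) ≤ 2 * γ₀ * d ∧ (∀ w ∈ Literature.Algebra.EuclideanLattices.dualLattice L, w ≠ 0 → 2 * Real.sqrt n / d ≤ ‖w‖) ∧ ∃ N : ℕ, 0 < N ∧ N ≤ n ^ C ∧ ∃ w : Fin N → EuclideanSpace ℝ (Fin n), (∀ j, w j ∈ Literature.Algebra.EuclideanLattices.dualLattice L) ∧ ∃ θ : ℝ, (∑ j, Real.cos (2 * Real.pi * ⟪w j, t⟫_ℝ)) < N * θ ∧ ∀ x : EuclideanSpace ℝ (Fin n), Metric.infDist x (L : Set (EuclideanSpace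 ℝ (Fin n))) ≤ d → N * θ ≤ ∑ j, Real.cos (2 * Real.pi * ⟪w j, x⟫_ℝ)

/-- item stmt-PneNP-2330 · crux · rank 4 · closed · proved by Summit.PneNP.PneNP.Theorems.ConA.booleanSosBlindAtConstantFactor_proof @ 6be5eaeb6b0a (prover) · by planner
why it might fail: Bit-encoded integers are not automatically low-degree-hard: degree-6 SOS refutes parity-far instances (2ℤⁿ, t = 1ⁿ), '2·binary = odd' dies in degree 4 (refuter note); the 3XOR→ABSS transfer (Schoenebeck/KMOW + Tulsiani) must keep degree n^δ in the lattice dimension through two's-complement bits.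
sources: arXiv170104521, Grigoriev2001, doi:10.1145/1536414.1536457, doi:10.1109/FOCS.2008.74, AroraEtAl1997, 2009.01874
[crux] First standard-proof-system rung. For some constant γ₀, some δ > 0 and C: in infinitely many
dimensions n there is a NO-instance p = ((B,t),d) of GapCVP_{γ₀} of bit-size ≤ n^C and a bit budget
m ≤ n^C such that degree-⌈n^δ⌉ SOS over the Boolean cube (tree: IsPseudoexpectation /
SatisfiesIdentity / boolAxiom of Computability/MetaComplexity/SumOfSquares.lean, KMOW primal form)
does NOT refute the closeness system: coefficient bits x_(i,b+1) with z_i = Σ_{b<m} 2^b x_(i,b+1) −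
2^{m−1}, slack bits x_(b,0), and the single identity ‖zB − t‖² + Σ_{b<m} 2^b x_(b,0) − ⌊d²⌋ = 0
(variables indexed by Nat.pair; the system has no Boolean solution because dist(t,L(B)) > γ₀d ≥ d
and ‖zB − t‖² is an integer). I.e. a degree-n^δ pseudoexpectation pretends that some bounded integer
vector z has ‖zB − t‖ ≤ d. Two roads: worst-case instances from random 3XOR through the
label-cover/ABSS gadget (KothariEtAl2017 / Schoenebeck degree Ω(n), Tulsiani-type low-degree
transfer — it must survive the bit encoding of integer coefficients, where Grigoriev-knapsack
phenomena live), or random q-ary instances with a planted far point by pseudo-calibration (new; the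
nearest worked case is SOS vs planted affine -/
@[route_item "route-PneNP-LatticeMagic", crux]
def BooleanSosBlindAtConstantFactor : Prop :=
  ∃ γ₀ : ℝ, 1 ≤ γ₀ ∧ ∃ δ : ℝ, 0 < δ ∧ ∃ C : ℕ, ∀ n₀ : ℕ, ∃ (p : Literature.Algebra.EuclideanLattices.GapCVPInstance) (m : ℕ), n₀ ≤ p.1.I.n ∧ p ∈ Literature.Algebra.EuclideanLattices.GapCVP.no (fun _ => γ₀) ∧ (Literature.Algebra.EuclideanLattices.GapCVPInstance.encode p).length ≤ p.1.I.n ^ C ∧ m ≤ p.1.I.n ^ C ∧ ∃ E : MvPolynomial ℕ ℝ →ₗ[ℝ] ℝ, Literature.Computability.MetaComplexity.IsPseudoexpectation ⌈(p.1.I.n : ℝ) ^ δ⌉₊ E ∧ (∀ v : ℕ, Literature.Computability.MetaComplexity.SatisfiesIdentity ⌈(p.1.I.n : ℝ) ^ δ⌉₊ E (Literature.Computability.MetaComplexity.boolAxiom v)) ∧ Literature.Computability.MetaComplexity.SatisfiesIdentity ⌈(p.1.I.n : ℝ) ^ δ⌉₊ E ((∑ k : Fin p.1.I.n, (∑ i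 : Fin p.1.I.n, ((∑ b ∈ Finset.range m, ((2 : ℝ) ^ b) • MvPolynomial.X (Nat.pair i.val (b + 1))) - MvPolynomial.C ((2 ^ (m - 1) : ℕ) : ℝ)) * MvPolynomial.C ((p.1.I.basis i k : ℤ) : ℝ) - MvPolynomial.C ((p.1.target k : ℤ) : ℝ)) ^ 2) + (∑ b ∈ Finset.range m, ((2 : ℝ) ^ b) • MvPolynomial.X (Nat.pair b 0)) - MvPolynomial.C ((⌊(p.2 : ℝ) ^ 2⌋ : ℤ) : ℝ))

/-- item stmt-PneNP-18325 · support · rank 3 · open · by planner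
[crux; piece A of the typed split of Target along Krajíček's squeeze — PRICE TAG: ≥ the summit]
Krajíček's Hypothesis (ST), VERBATIM (arXiv:2506.20221 §2): some STRONG (EF-simulating) Cook–Reckhow
proof system V for TAUT has its disjoint-disjunction search problem DD_V (given a V-proof of a
disjunction of pairwise variable-disjoint formulas, find a tautological disjunct) NOT solvable by a
p-time student with O(1) rounds of counterexamples (tree: STHyp V, SimulatesEF V of
Theorems/LatticeMagicTargetDefs; this is the definiens of StrongST). Evidence: Lemma 2.2 (strong
one-way permutations ⟹ (ST), Krajíček LMCS 2020); in the tree the EF-free form ∃ V, IsProofSystemFor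
V TAUT ∧ STHyp V is DERIVED from an injective one-way family with a hard-core bit (st_of_injOWF,
landed: game/Levin/bridge) and the EF clause needs only an EF Cook–Reckhow verifier (birth
skeleton). PRICE TAG (explicit, per the EXEMPT-46 ruling): (ST) refutes TAUT ∈ P
(stHyp_false_of_TAUT_mem_P) hence proves P ≠ NP and the summit PneNP (landed
Target.Negative.pneNP_of_stHyp) — the split decomposes the crux's SURPLUS NP ≠ coNP over P ≠ NP; it
is not known to be implied by the crux or by the summit. [difficulty: conjecture -/
@[route_item "route-PneNP-LatticeMagic"]
def HypothesisST : Prop :=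
  ∃ V : List Bool → List Bool → Bool, Literature.Computability.MetaComplexity.IsProofSystemFor V Literature.Computability.Complexity.TAUT ∧ Summit.PneNP.PneNP.Theorems.LatticeMagicTarget.SimulatesEF V ∧ Summit.PneNP.PneNP.Theorems.LatticeMagicTarget.STHyp V

/-- item stmt-PneNP-2329 · support · rank 3 · closed · proved by Summit.PneNP.PneNP.Theorems.taylorMinorantsBuySqrtK_proof @ 2202365fa03e (prover) · by planner
why it might fail: Expected provable (sphere-average argument in NOTES, slack ≈ 26×); it fails only if that moment arithmetic is off, in which case the constant 2 or the side condition K ≤ n changes, not the shape. As a CRUX it tests whether 'order buys √K' is really format-independent.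
sources: arXiv221111693, AharonovRegev2005
[crux] Calibration of the whole Aharonov–Regev / ABB+ certificate family, stated lattice-free. An
ORDER-K TAYLOR-MINORANT certificate of 'dist(t,L) > r' consists of dual vectors w_j, real weights
c_j and orders M_j ≤ K with the parity rule (c_j ≥ 0 ⇒ M_j odd, so T_{M_j} ≤ cos on ℝ; c_j < 0 ⇒ M_j
even, T_{M_j} ≥ cos), T_M(y) = Σ_{i≤M} (−1)^i y^{2i}/(2i)!, a proof of any kind (PSD test, SOS of
any degree, moment checks) that the polynomial P(e) = Σ_j c_j T_{M_j}(2π⟨w_j,e⟩) is ≥ θ on the ball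
‖e‖ ≤ r, and the evaluation Σ_j c_j cos 2π⟨w_j,t⟩ < θ; soundness = L-periodicity + the global Taylor
inequalities (AharonovRegev2005 §6.1 is K = 1 with the eigenvalue test; arXiv:2211.11693 Thm 1.2 /
pp.9-10 is order k with moment tests, reaching factor ≈ √(n/k) for SVP). STATEMENT: if K ≤ n and
every nonzero w_j has ‖w_j‖ ≥ 2√(Kn)/r, then some e in the ball has P(e) ≤ Σ_{w_j = 0} c_j − Σ_{w_j
≠ 0} |c_j| (≤ inf_t Σ_j c_j cos 2π⟨w_j,t⟩), so NO threshold θ can separate any t: order-K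
certificates are blind on every lattice whose dual has no vector shorter than 2√(Kn)/r, whatever
their size, weights or SOS degree. With transference-tight instances (λ₁(L*)·dist(t,L) ≥ c·n, e.g.
random q-ary lattices) -/
@[route_item "route-PneNP-LatticeMagic", crux]
def TaylorMinorantsBuySqrtK : Prop :=
  ∀ (n K N : ℕ) (r : ℝ), 0 < r → K ≤ n → ∀ (c : Fin N → ℝ) (w : Fin N → EuclideanSpace ℝ (Fin n)) (M : Fin N → ℕ), (∀ j, M j ≤ K ∧ (0 ≤ c j → Odd (M j)) ∧ (c j < 0 → Even (M j)) ∧ (w j = 0 ∨ 2 * Real.sqrt ((K : ℝ) * n) / r ≤ ‖w j‖)) → ∃ e : EuclideanSpace ℝ (Fin n), ‖e‖ ≤ r ∧ (∑ j, c j * ∑ i ∈ Finset.range (M j + 1), (-1 : ℝ) ^ i * (2 * Real.pi * ⟪w j, e⟫_ℝ) ^ (2 * i) / (Nat.factorial (2 * i) : ℝ)) ≤ (∑ j ∈ Finset.univ.filter (fun j => w j = 0), c j) - ∑ j ∈ Finset.univ.filter (fun j => w j ≠ 0), |c j|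

/-- item stmt-PneNP-10679 · support · rank 9 · closed · proved by Summit.PneNP.PneNP.Theorems.cookModelBridge_proof @ a9cf7dce24c0 (prover) · by planner
sources: CookClay2006, AroraBarakCC2009
[support — KNOWN, already PROVED in the tree; model bridge used by the deciding theorem `closes`]
Cook's Clay-problem classes over {0,1} (Literature.Computability.Complexity.PNPWave0.P Bool and
PNPWave0.NP Bool, in which the summit statement PneNP is phrased) coincide with the tree's working
classes Classes.P = ⋃_k DTIME(n^k) and Nondeterministic.NP = polyExists P. Literally the conjunction
of the PROVED Literature theorems Literature.Computability.Complexity.P_bool_eq_holds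
(ClayProblem.lean) and Literature.Computability.Complexity.NP_bool_eq_holds
(ClayProblemProofs.lean): a prover closes it in one line, `theorem cookModelBridge :
SzkEntropy.CookModelBridge := ⟨P_bool_eq_holds, NP_bool_eq_holds⟩`, in a Theorems file importing
ClayProblemProofs. Filed as an ITEM rather than invoked inside `closes` so that the route FILE
imports neither ClayProblem (which declares the open conjecture NPNotSubsetPPoly) nor its proof cone
— the 2026-08-15 route-repair keeps the route's import and constant cones free of unproved named
facts. [AroraBarakCC2009 Def. 1.13 and 2.1; CookClay2006 §1] [difficulty: provable-now] -/
@[route_item "route-PneNP-LatticeMagic", crux]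
def ModelBridge : Prop :=
  Literature.Computability.Complexity.PNPWave0.P Bool = Literature.Computability.Complexity.Classes.P ∧ Literature.Computability.Complexity.PNPWave0.NP Bool = Literature.Computability.Complexity.Nondeterministic.NP

/-- `ModelBridge` holds: proved by `Summit.PneNP.PneNP.Theorems.cookModelBridge_proof` @ a9cf7dce24c0. -/
theorem ModelBridge_holds : ModelBridge := _root_.Summit.PneNP.PneNP.Theorems.cookModelBridge_proof

-- earlier SanityFromNPHardness (stmt-PneNP-2332, replaced 2026-08-15T16:21:35Z -> stmt-PneNP-10710): retired by None — (∃ c : ℝ, 1 ≤ c ∧ (Literature.Algebra.EuclideanLattices.gapCVPPromise (fun _ => c)).IsNPHard) → Literature.Computability.Complexity.Nondeterministic.NP ≠ Literature.Computability.Complexity.coNP → ∃ c : ℝ, 1 ≤ c ∧ Literature.Algebra.EuclideanLattices.gapCVPPromise (fun _ => c) ∉ Lit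
/-- item stmt-PneNP-10710 · support · rank 9 · closed · proved by Summit.PneNP.PneNP.Theorems.sanityFromNPHardness_proof @ 3a6914104d5a (prover) · by planner
sources: AroraEtAl1997, AharonovRegev2005
[support] X is no stronger than NP ≠ coNP: if GapCVP_c is NP-hard under deterministic Karp
reductions for some constant c ≥ 1 (AroraEtAl1997 for every constant; c = 1 is exact CVP) and NP ≠
coNP, then GapCVP_c ∉ PromiseCoNP (tree: np_subset_coNP_of_isNPHard_of_mem_PromiseCoNP, plus NP ⊆
coNP ⇒ NP = coNP by complementation). The NP-hardness is a HYPOTHESIS here (the ABSS instance map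
cvpBasis exists in KhotBasicReduction.lean; a grounder may convert it to a cite fact). REV 2:
GapCVP_c written as `PromiseProblem.ofEncoding gapCVPInstanceEncoding (GapCVP.yes _) (GapCVP.no _)`
(= gapCVPPromise, Iff.rfl) for the same cone reason as Target. [difficulty: S] -/
@[route_item "route-PneNP-LatticeMagic", crux]
def SanityFromNPHardness : Prop :=
  (∃ c : ℝ, 1 ≤ c ∧ (Literature.Computability.Complexity.PromiseProblem.ofEncoding Literature.Algebra.EuclideanLattices.gapCVPInstanceEncoding (Literature.Algebra.EuclideanLattices.GapCVP.yes (fun _ => c)) (Literature.Algebra.EuclideanLattices.GapCVP.no (fun _ => c))).IsNPHard) → Literature.Computability.Complexity.Nondeterministic.NP ≠ Literature.Computability.Complexity.coNP → ∃ c : ℝ, 1 ≤ c ∧ Literature.Computability.Complexity.PromiseProblem.ofEncoding Literature.Algebra.EuclideanLattices.gapCVPInstanceEncoding (Literature.Algebra.EuclideanLattices.GapCVP.yes (fun _ => c)) (Literature.Algebra.EuclideanLattices.GapCVP.no (fun _ => c)) ∉ Literature.Computability.Complexity.PromiseCoNP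

/-- item stmt-PneNP-10712 · support · rank 9 · closed · proved by Summit.PneNP.PneNP.Theorems.gapCVPInPromiseNP_proof @ 045c7b513df3 (prover) · by planner
sources: AharonovRegev2005, MicciancioGoldwasser2002
[support] GapCVP_γ ∈ PromiseNP for every factor γ ≥ 1 (AharonovRegev2005, §1 p.2: 'containment in NP
is trivial' — a witness for dist(t,L(B)) ≤ d is a lattice vector u with ‖t − u‖ ≤ d;
MicciancioGoldwasser2002 Ch.1 §1.2): some NP language contains the code of every YES-instance
((B,t),d) and of no NO-instance. VERBATIM the definiens of the tree fact
`Literature.Algebra.EuclideanLattices.gapCVP_mem_promiseNP` (LatticeGapCVPNPcoNP.lean), which is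
PROVED in the tree (`gapCVP_mem_promiseNP_holds`, GapCVPVerifier.lean: TM2 verifier ‖zB − t‖² ≤ d²
with Cramer/Hadamard coefficient bounds). Filed as an item only so that the deciding theorem can use
NP-membership without importing the verifier development (its import cone reaches
LatticeComplexity.lean's unproved XL facts). Closes by the one-liner `theorem gapCVPInPromiseNP :
Summit.PneNP.PneNP.Theses.LatticeMagic.GapCVPInPromiseNP :=
Literature.Algebra.EuclideanLattices.gapCVP_mem_promiseNP_holds` (rfl-checked in the planner's
Sketch2.lean). [difficulty: provable-now] -/
@[route_item "route-PneNP-LatticeMagic", crux]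
def GapCVPInPromiseNP : Prop :=
  ∀ γ : ℕ → ℝ, (∀ n, 1 ≤ γ n) → Literature.Computability.Complexity.PromiseProblem.ofEncoding Literature.Algebra.EuclideanLattices.gapCVPInstanceEncoding (Literature.Algebra.EuclideanLattices.GapCVP.yes γ) (Literature.Algebra.EuclideanLattices.GapCVP.no γ) ∈ Literature.Computability.Complexity.PromiseNP

/-- item stmt-PneNP-16059 · support · rank 9 · closed · proved by Summit.PneNP.PneNP.Theorems.ConAScaled.booleanSosBlindAtEveryFactor_proof @ 34c8d45c865c (prover) · by planner
[support] METHODS-CLASS strengthening of the proved crux BooleanSosBlindAtConstantFactor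
(stmt-PneNP-2330; task strengthen-sos-blind, coordinator): FACTOR-INSENSITIVITY of the Boolean
bit-SOS rung at LINEAR degree. There is an absolute c > 0 such that for every k (bit-size exponent C
= C(k)) and every factor function γ with 1 ≤ γ(n) ≤ 2^(n^k) eventually, in infinitely many
dimensions n some NO-instance p of GapCVP_γ of bit-size ≤ n^C with bit budget m ≤ n^C has its
bit-encoded closeness system (verbatim the crux's: two's-complement coefficient bits, slack bits,
the single identity ‖zB − t‖² + Σ2^b s_b − ⌊d²⌋ = 0, Booleanity) satisfied by a degree-⌈c·n⌉
pseudoexpectation (KMOW Def 2.7/2.8, tree IsPseudoexpectation/SatisfiesIdentity/boolAxiom). I.e. the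
rung is blind at EVERY factor representable in the input — at c√n where GapCVP ∈ coNP
(AharonovRegev2005) and at 2^n where it is in P (LLL/Babai): bit-SOS degree measures
Gaussian-elimination content, not lattice geometry, and is incomparable with the AR rung. ROAD
(PlanSkeleton.lean, composition booleanSosBlindAtEveryFactor_plan KERNEL-CHECKED from 4 stubs): the
landed Construction-A pullback (Theorems/LatticeMagicBooleanSosBlindAtCo -/
@[route_item "route-PneNP-LatticeMagic"]
def BooleanSosBlindAtEveryFactor : Prop :=
  ∃ c : ℝ, 0 < c ∧ ∀ k : ℕ, ∃ C : ℕ, ∀ γ : ℕ → ℝ, (∀ n, 1 ≤ γ n) → (∃ n₁ : ℕ, ∀ n, n₁ ≤ n → γ n ≤ 2 ^ (n ^ k)) → ∀ n₀ : ℕ, ∃ (p : Literature.Algebra.EuclideanLattices.GapCVPInstance) (m : ℕ), n₀ ≤ p.1.I.n ∧ p ∈ Literature.Algebra.EuclideanLattices.GapCVP.no γ ∧ (Literature.Algebra.EuclideanLattices.GapCVPInstance.encode p).length ≤ p.1.I.n ^ C ∧ m ≤ p.1.I.n ^ C ∧ ∃ E : MvPolynomial ℕ ℝ →ₗ[ℝ]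 ℝ, Literature.Computability.MetaComplexity.IsPseudoexpectation ⌈c * (p.1.I.n : ℝ)⌉₊ E ∧ (∀ v : ℕ, Literature.Computability.MetaComplexity.SatisfiesIdentity ⌈c * (p.1.I.n : ℝ)⌉₊ E (Literature.Computability.MetaComplexity.boolAxiom v)) ∧ Literature.Computability.MetaComplexity.SatisfiesIdentity ⌈c * (p.1.I.n : ℝ)⌉₊ E ((∑ k : Fin p.1.I.n, (∑ i : Fin p.1.I.n, ((∑ b ∈ Finset.range m, ((2 : ℝ) ^ b) • MvPolynomial.X (Nat.pair i.val (b + 1))) - MvPolynomial.C ((2 ^ (m - 1) : ℕ) : ℝ)) * MvPolynomial.C ((p.1.I.basis i k : ℤ) : ℝ) - MvPolynomial.C ((p.1.target k : ℤ) : ℝ)) ^ 2) + (∑ b ∈ Finset.range m, ((2 : ℝ) ^ b) • MvPolynomial.X (Nat.pair b 0)) - MvPolynomial.C ((⌊(p.2 : ℝ) ^ 2⌋ : ℤ) : ℝ))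

/-- item stmt-PneNP-16060 · support · rank 9 · open · by planner
[support] METHODS-CLASS strengthening of the proved crux BooleanSosBlindAtConstantFactor
(stmt-PneNP-2330; task strengthen-sos-blind): the γ-SENSITIVE, CONDITIONED bit-SOS rung with the
degree/factor law. There are absolute c > 0 and C such that for every constant factor γ₀ ≥ 1, in
infinitely many dimensions n some NO-instance p of GapCVP_{γ₀} with basis entries in {0,±1,±2} and
target entries in {0,±1} (no scaling possible; CVP on (0,1)-matrix lattices is NP-hard,
doi:10.1016/0020-0190(92)90011-j), bit-size ≤ n^C, bit budget m ≤ n^C, has its bit-encoded closeness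
system (verbatim the crux's) satisfied by a degree-⌈c·n/γ₀²⌉ Boolean pseudoexpectation: linear
degree at every constant factor (δ = 1, γ₀ bounded away from 1 at will), with the law D·γ₀² ≈ c·n of
the same shape as rung #3's Taylor-order law K ≈ n/(4γ²) (TaylorMinorantsBuySqrtK). ROAD
(PlanSkeleton.lean, composition booleanSosBlindBoundedEntries_plan KERNEL-CHECKED from 5 stubs):
REPEAT each parity check R = ⌈γ₀²⌉ times in the LANDED Construction-A instance (conAInstance N
(6N·R) (repFamily C R) K — each copy has its own escape coefficient; the Grigoriev–Schoenebeck
functional of C is pulled back along the copy map π, gene -/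
@[route_item "route-PneNP-LatticeMagic"]
def BooleanSosBlindBoundedEntries : Prop :=
  ∃ c : ℝ, 0 < c ∧ ∃ C : ℕ, ∀ γ₀ : ℝ, 1 ≤ γ₀ → ∀ n₀ : ℕ, ∃ (p : Literature.Algebra.EuclideanLattices.GapCVPInstance) (m : ℕ), n₀ ≤ p.1.I.n ∧ p ∈ Literature.Algebra.EuclideanLattices.GapCVP.no (fun _ => γ₀) ∧ (∀ i j, |p.1.I.basis i j| ≤ 2) ∧ (∀ k, |p.1.target k| ≤ 1) ∧ (Literature.Algebra.EuclideanLattices.GapCVPInstance.encode p).length ≤ p.1.I.n ^ C ∧ m ≤ p.1.I.n ^ C ∧ ∃ E : MvPolynomial ℕ ℝ →ₗ[ℝ] ℝ, Literature.Computability.MetaComplexity.IsPseudoexpectation ⌈c * (p.1.I.n : ℝ) / γ₀ ^ 2⌉₊ E ∧ (∀ v : ℕ, Literature.Computability.MetaComplexity.SatisfiesIdentity ⌈c * (p.1.I.n : ℝ) / γ₀ ^ 2⌉₊ E (Literature.Computability.MetaComplexity.boolAxiom v)) ∧ Literature.Computability.MetaComplexity.SatisfiesIdentity ⌈c * (p.1.I.n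 : ℝ) / γ₀ ^ 2⌉₊ E ((∑ k : Fin p.1.I.n, (∑ i : Fin p.1.I.n, ((∑ b ∈ Finset.range m, ((2 : ℝ) ^ b) • MvPolynomial.X (Nat.pair i.val (b + 1))) - MvPolynomial.C ((2 ^ (m - 1) : ℕ) : ℝ)) * MvPolynomial.C ((p.1.I.basis i k : ℤ) : ℝ) - MvPolynomial.C ((p.1.target k : ℤ) : ℝ)) ^ 2) + (∑ b ∈ Finset.range m, ((2 : ℝ) ^ b) • MvPolynomial.X (Nat.pair b 0)) - MvPolynomial.C ((⌊(p.2 : ℝ) ^ 2⌋ : ℤ) : ℝ))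

-- earlier Assembly (stmt-PneNP-2327, replaced 2026-08-15T16:21:35Z -> stmt-PneNP-10711): retired by None — Literature.Algebra.EuclideanLattices.gapCVP_mem_promiseNP → Literature.Computability.Complexity.P_bool_eq → Literature.Computability.Complexity.NP_bool_eq → Literature.Computability.Complexity.co_P → Literature.Computability.Complexity.P_subset_NP → (∃ c : ℝ, 1 ≤ c ∧ Literature.Algebra.Euclidea
/-- item stmt-PneNP-10711 · assembly · rank 1 · closed · proved by Summit.PneNP.PneNP.Theorems.latticeMagic_assembly_proof @ 86c75d189fc4 (prover) · by planner
sources: AharonovRegev2005, MicciancioGoldwasser2002, CookClay2006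
[assembly] Honest bookkeeping form (rev 2): GapCVP_c ∈ PromiseNP (GapCVPInPromiseNP, proved tree
fact) → the machine-model bridges (ModelBridge, proved tree facts) → X (Target) → PneNP. Proof (15
lines, = the body of the deciding theorem `closes`, attached as item evidence Sketch.lean): if
¬PneNP then every L ∈ PNPWave0.NP Bool lies in PNPWave0.P Bool; the NP separator L of GapCVP_c
(GapCVPInPromiseNP at γ ≡ c) is in Nondeterministic.NP = PNPWave0.NP Bool, hence in PNPWave0.P Bool
= Classes.P = co P (co_P_holds), so Lᶜ ∈ P ⊆ NP (P_subset_NP_holds), i.e. L ∈ coNP separates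
GapCVP_c: GapCVP_c ∈ PromiseCoNP, contradicting Target. Rev 1 named the facts gapCVP_mem_promiseNP,
P_bool_eq, NP_bool_eq, co_P, P_subset_NP directly; the first three moved into the two support items
(their home files are outside the repaired import cone), the last two are proved inside the cone and
used as theorems. [difficulty: provable-now] -/
@[route_item "route-PneNP-LatticeMagic", crux]
def Assembly : Prop :=
  GapCVPInPromiseNP → ModelBridge → Target → _root_.PneNP

/-! D-0027 §2.1 — DECIDING THEOREM (planner-authored via `route open/edit --closes-file`; by planner-rbadge-PneNP-LatticeMagic-22161f16-g2-0 2026-08-15T16:28:48Z):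
its hypotheses are this route's items and its conclusion the sub-problem Statement (glue_lint), and it elaborates with this file. -/

@[closes "route-PneNP-LatticeMagic"] theorem closes (hT : Target) (_h₂ : MagicFunctionsPersist) (_h₄ : BooleanSosBlindAtConstantFactor)
    (_h₃ : TaylorMinorantsBuySqrtK) (_hS : SanityFromNPHardness) (hNP : GapCVPInPromiseNP)
    (hB : ModelBridge) (_hA : Assembly) : _root_.PneNP := by
  obtain ⟨c, hc, hnot⟩ := hT
  obtain ⟨hPeq, hNPeq⟩ := hB
  by_contra hne
  apply hnot
  obtain ⟨L, hL, hyes, hno⟩ := hNP (fun _ => c) (fun _ => hc)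
  have hL0 : L ∈ Literature.Computability.Complexity.PNPWave0.NP Bool := by
    rw [hNPeq]; exact hL
  have hLP0 : L ∈ Literature.Computability.Complexity.PNPWave0.P Bool := by
    by_contra hLP0
    exact hne ⟨L, hL0, hLP0⟩
  have hLP : L ∈ Literature.Computability.Complexity.Classes.P := by
    rw [← hPeq]; exact hLP0
  have hLcP : Lᶜ ∈ Literature.Computability.Complexity.Classes.P := by
    have h : L ∈ Literature.Computability.Complexity.co Literature.Computability.Complexity.Classes.P := by
      rw [Literature.Computability.Complexity.co_P_holds]; exact hLP
    exact h
  have hLcoNP : L ∈ Literature.Computability.Complexity.coNP := by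
    show Lᶜ ∈ Literature.Computability.Complexity.Nondeterministic.NP
    exact Literature.Computability.Complexity.P_subset_NP_holds hLcP
  exact ⟨L, hLcoNP, hyes, hno⟩

end Summit.PneNP.PneNP.Theses.LatticeMagic
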